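import Summits.QuantumFields.YangMills.Theorems.SwapVirialDeficitBlowUpPeriodicBox
import Summits.QuantumFields.YangMills.Theorems.SwapVirialDeficitZeroModeGroupFourSmallBallRegions
import Summits.QuantumFields.YangMills.Theorems.SwapVirialDeficitBlowUpLeaderDominator
import HarnessLib

/-!
# The PERIODIC massive-mode rung, brick PD-II: the DEEP and OUTER hypotheses of the log-squeeze lemma for the periodic kernel — from fcl-p3 g44's K4
# bounds times the follower-box volume, NO new geometry
# (free-hands support of ⟨stmt-QuantumFields-24196⟩ `SwapVirialDeficit.ToronSoftnessSharp`; memo `w3-g64-memo-24196-periodic-massive-mode-rung.md` §2 PD;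
# consumes ✓PD-I `…BlowUpPeriodicBox`, ✓PH `periodicKernel`, K4 ✓`dilate3_mem_fourSet_iff` / ✓`volume_rescaledSet4_eq_twoScale` / ✓`lintegral_radK_deep_le` /
# ✓`lintegral_radK_outer_le`; delivers (hdeep)/(houter) of ✓`BlowUp.tendsto_div_log_of_twoScale`)

With `K_t = periodicKernel 0 1 t (r·t²)` (principal sector, `χ ≡ 1`, level `r ≥ 0`, blow-up scale `t`) and `R := 20L²√r` (the threshold RATIO of
✓`periodicChartBox_of_chartDeficit`):
* §1 the LEADER EVENT `{w | dil3P t w ∈ B³ ∧ axialLetters (a, dil3P t w) ∈ N₄(R·t)}` at the axial hub `a = hubAt a₀ ρ²` (`ρ > 0`) has volume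
  `≤ R⁶ · hubFun (R t) a₀ ρ²` (★★ `volume_leaderEvent_le`): off the null set of vanishing letters it lies in `(dil3P R⁻¹)⁻¹(rescaledSet4 (R t)² a)`
  (`dil3P t = dil3P (R t) ∘ dil3P R⁻¹`, ✓`dilate3_mem_fourSet_iff`), `vol³ ∘ (dil3P R⁻¹)⁻¹ = R⁶·vol³`, and ✓`volume_rescaledSet4_eq_twoScale` IS `hubFun`
  at `hubAt a₀ ρ²` (★ `volume_rescaledSet4_hubAt`);
* §2 ★★ `periodicKernel_le_radK` — for `ρ > 0`: `K_t(a₀, ρ) ≤ (4π · vol^{Fol}(box) · R⁶) · radK (R t) a₀ ρ` (fcl-p3 g44's radial integrand);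
* §3 ★★★ `periodicKernel_deep` and ★★★ `periodicKernel_outer` — LITERALLY hypotheses (hdeep) ∕ (houter) of ✓`BlowUp.tendsto_div_log_of_twoScale` for
  `K t := periodicKernel 0 1 t (r t²)`: `∀ A > 0, ∃ C < ∞, ∀ᶠ t, ∫⁻ a₀, (∫⁻ ρ in Ioc 0 (A√t), K_t) ≤ C` (✓`lintegral_radK_deep_le` at `τ = R t`, `a = A√t`:
  the bound `2·(A√2/(64√R))·C_dec` is `t`-FREE) and `∀ δ > 0, ∃ C < ∞, ∀ᶠ t, ∫⁻ a₀, (∫⁻ ρ in Ioi δ, K_t) ≤ C` (✓`lintegral_radK_outer_le`).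
What remains for the periodic principal log-limit is PM (the two-scale fibre LIMIT, hypotheses (upper)/(lower)) and PJ6 (assembly).
HONEST LABEL: measure-theoretic bookkeeping (plumbing for a plan-level fixed-`L` rung of a DRAFT line); NOT ⟨24196⟩/⟨24497⟩; own crux ⟨22884⟩ OPEN (blocked-on
⟨19935⟩); the Yang–Mills mass gap is NOT proved; no summit is proved by a line.
Width seat ym-line-sfw-p2-w3 g64 (cell ym-idea-1, free hands), `--supports stmt-QuantumFields-24196`.  THEOREMS ONLY (0 `def`, 0 `sorry`), standard axioms.
References: [cite: Luscher1983, §2]; [cite: GonzalezarroyoAltes1988]; [folklore].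
-/

set_option autoImplicit false

noncomputable section

open MeasureTheory Quaternion Set Filter Topology
open scoped Quaternion ENNReal BigOperators
open Literature.MathematicalPhysics.QuantumLattice
open Literature.MathematicalPhysics.QuantumFieldTheory hiding SU2
open Literature.MathematicalPhysics.QuantumFieldTheory.Balaban1983to89.T4HaarSU2Translate (su2Quat_quatToSU2)
open Literature.Analysis.Calculus (radialUnit radialUnit_def norm_radialUnit)
open Summit.QuantumFields.YangMills.Theorems.SwapTwistDeficit.ToronLog

attribute [local instance] Literature.Analysis.FluidPDE.Tao2016.quatMeasurableSpace
  Literature.Analysis.FluidPDE.Tao2016.quatBorelSpace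
  Literature.MathematicalPhysics.QuantumLattice.secondCountableTopology_su2

namespace Summit.QuantumFields.YangMills.Theorems.SwapVirialDeficit.BlowUpRing

open Summit.QuantumFields.YangMills.Theorems.FemtoTransferGap
open Summit.QuantumFields.YangMills.Theorems.FemtoTransferGap.TT
open Summit.QuantumFields.YangMills.Theorems.VirialFluxGap.RingDeficit
open Summit.QuantumFields.YangMills.Theorems.SwapVirialDeficit.ZeroModeSigma (ball3 measurableSet_ball3 mem_ball3_iff dilateIm isAddHaarMeasure_volume3)
open Summit.QuantumFields.YangMills.Theorems.SwapVirialDeficit.ZeroModeGroup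
open Summit.QuantumFields.YangMills.Theorems.SwapVirialDeficit.BlowUp (axialLetters axialLetters_def dil3P dil3P_apply dil3P_eq_prodMap det_dil3P
  measurable_dil3P quatToSU2_radialUnit dilate_dilate dilate_ne_zero)

variable {L : ℕ} [NeZero L]

/-! ## §1 The leader event at an axial hub -/

/-- `dil3P` is a one-parameter group: `dil3P (s·s') = dil3P s ∘ dil3P s'` (✓`dilate_dilate`). [folklore] -/
theorem dil3P_mul (s s' : ℝ) (w : (ℍ × ℍ) × ℍ) : dil3P (s * s') w = dil3P s (dil3P s' w) := by
  rw [dil3P_apply, dil3P_apply, dil3P_apply, dilate_dilate, dilate_dilate, dilate_dilate]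

/-- The hub `hubAt a₀ σ` is axial: `imJ = imK = 0`, `imI = √σ`, `re = a₀`, and `‖hubAt a₀ σ‖² = a₀² + σ` (`σ ≥ 0`). [folklore] -/
theorem hubAt_components {a₀ σ : ℝ} (hσ : 0 ≤ σ) :
    (hubAt a₀ σ).re = a₀ ∧ (hubAt a₀ σ).imI = Real.sqrt σ ∧ (hubAt a₀ σ).imJ = 0 ∧ (hubAt a₀ σ).imK = 0 ∧ ‖hubAt a₀ σ‖ ^ 2 = a₀ ^ 2 + σ := by
  refine ⟨rfl, rfl, rfl, rfl, ?_⟩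
  rw [sq_norm_eq_sum_sq]
  show a₀ ^ 2 + Real.sqrt σ ^ 2 + 0 ^ 2 + 0 ^ 2 = a₀ ^ 2 + σ
  rw [Real.sq_sqrt hσ]; ring

/-- ★ **K4's two-scale volume at the prescribed hub IS `hubFun`**: `vol³(rescaledSet4 (τ²) (hubAt a₀ ρ²)) = hubFun τ a₀ ρ²` (`ρ > 0`;
✓`volume_rescaledSet4_eq_twoScale`). [folklore] -/
theorem volume_rescaledSet4_hubAt (τ a₀ : ℝ) {ρ : ℝ} (hρ : 0 < ρ) :
    (((volume : Measure ℍ).prod (volume : Measure ℍ)).prod (volume : Measure ℍ)) (rescaledSet4 (τ ^ 2) (hubAt a₀ (ρ ^ 2))) = hubFun τ a₀ (ρ ^ 2) := by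
  obtain ⟨-, hI, -, -, hn2⟩ := hubAt_components (a₀ := a₀) (sq_nonneg ρ)
  rw [Real.sqrt_sq hρ.le] at hI
  have hIpos : 0 < (hubAt a₀ (ρ ^ 2)).imI := by rw [hI]; exact hρ
  have hn : ‖hubAt a₀ (ρ ^ 2)‖ = Real.sqrt (a₀ ^ 2 + ρ ^ 2) := by
    rw [← hn2, Real.sqrt_sq (norm_nonneg _)]
  rw [volume_rescaledSet4_eq_twoScale hIpos, hubFun_sq hρ, hI, hn]
  have hs : Real.sqrt (a₀ ^ 2 + ρ ^ 2) ^ 2 = a₀ ^ 2 + ρ ^ 2 := Real.sq_sqrt (by positivity)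
  have hs4 : Real.sqrt (a₀ ^ 2 + ρ ^ 2) ^ 4 = (a₀ ^ 2 + ρ ^ 2) ^ 2 := by rw [show (4:ℕ) = 2 * 2 by norm_num, pow_mul, hs]
  rw [hs, hs4]

/-- At a non-degenerate point the periodic letters' quaternion commutators are the `commSq` of the raw letters: if `axialLetters (a, w') ∈ N₄(τ)` with all letters
and the hub non-zero, then `w' ∈ fourSet τ a` for an AXIAL hub `a` (`axisPoint a = a`). [folklore] -/
theorem mem_fourSet_of_axialLetters_mem {τ : ℝ} {a : ℍ} (haxis : axisPoint a = a) (ha : a ≠ 0) {w : (ℍ × ℍ) × ℍ}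
    (hx : w.1.1 ≠ 0) (hy : w.1.2 ≠ 0) (hz : w.2 ≠ 0) (hN : axialLetters (a, w) ∈ nearlyCommuting τ) : w ∈ fourSet τ a := by
  simp only [nearlyCommuting, Set.mem_setOf_eq, axialLetters_def, haxis] at hN
  have key : ∀ {u v : ℍ}, u ≠ 0 → v ≠ 0 →
      ‖su2Quat (quatToSU2 u) * su2Quat (quatToSU2 v) - su2Quat (quatToSU2 v) * su2Quat (quatToSU2 u)‖ ≤ τ → commSq u v ≤ τ ^ 2 := by
    intro u v hu hv h
    rw [← norm_comm_su2Quat_quatToSU2_sq hu hv]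
    exact pow_le_pow_left₀ (norm_nonneg _) h 2
  have h02 := hN 0 2; have h01 := hN 0 1; have h21 := hN 2 1; have h03 := hN 0 3; have h23 := hN 2 3; have h13 := hN 1 3
  simp only [Matrix.cons_val_zero, Matrix.cons_val_one, Matrix.cons_val] at h02 h01 h21 h03 h23 h13
  exact ⟨key hx hy h02, key hx hz h01, key hy hz h21, key hx ha h03, key hy ha h23, key hz ha h13⟩

/-- The raw letters of `dil3P s w` vanish iff those of `w` do (`s ≠ 0`). [folklore] -/
theorem dil3P_letters_ne_zero {s : ℝ} (hs : s ≠ 0) {w : (ℍ × ℍ) × ℍ} (hx : w.1.1 ≠ 0) (hy : w.1.2 ≠ 0) (hz : w.2 ≠ 0) :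
    (dil3P s w).1.1 ≠ 0 ∧ (dil3P s w).1.2 ≠ 0 ∧ (dil3P s w).2 ≠ 0 := by
  rw [dil3P_apply]
  exact ⟨dilate_ne_zero hs hx, dilate_ne_zero hs hy, dilate_ne_zero hs hz⟩

/-- ★★ **THE LEADER EVENT IS CONTAINED IN THE `R⁻¹`-DILATED K4 EVENT, up to a null set**: for `t, R > 0`, an axial hub `a ≠ 0`, and `w` with non-zero letters,
`dil3P t w ∈ B³ ∧ axialLetters (a, dil3P t w) ∈ N₄(R t)` implies `dil3P R⁻¹ w ∈ rescaledSet4 ((R t)²) a`. [folklore] -/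
theorem dil3P_inv_mem_rescaledSet4 {t R : ℝ} (ht : 0 < t) (hR : 0 < R) {a : ℍ} (haxis : axisPoint a = a) (ha : a ≠ 0) {w : (ℍ × ℍ) × ℍ}
    (hx : w.1.1 ≠ 0) (hy : w.1.2 ≠ 0) (hz : w.2 ≠ 0) (hball : dil3P t w ∈ ball3) (hN : axialLetters (a, dil3P t w) ∈ nearlyCommuting (R * t)) :
    dil3P R⁻¹ w ∈ rescaledSet4 ((R * t) ^ 2) a := by
  have hRt : 0 < R * t := mul_pos hR ht
  obtain ⟨hx', hy', hz'⟩ := dil3P_letters_ne_zero ht.ne' hx hy hz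
  have hfour : dil3P t w ∈ fourSet (R * t) a := mem_fourSet_of_axialLetters_mem haxis ha hx' hy' hz' hN
  have hJ : a.imJ = 0 := by rw [← haxis]; rfl
  have hK : a.imK = 0 := by rw [← haxis]; rfl
  have he : dil3P t w = Prod.map (Prod.map (dilate (R * t)) (dilate (R * t))) (dilate (R * t)) (dil3P R⁻¹ w) := by
    rw [← dil3P_eq_prodMap, ← dil3P_mul, mul_assoc, mul_comm t, ← mul_assoc, mul_inv_cancel₀ hR.ne', one_mul]
  refine (dilate3_mem_fourSet_iff hRt hJ hK (dil3P R⁻¹ w)).1 ?_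
  rw [← he]
  refine ⟨hfour, ?_⟩
  simpa only [ball3] using hball

/-- Almost every `w ∈ (ℍ × ℍ) × ℍ` has non-zero letters. [folklore] -/
theorem ae_volume3_letters_ne_zero : ∀ᵐ w : (ℍ × ℍ) × ℍ ∂(volume : Measure ((ℍ × ℍ) × ℍ)), w.1.1 ≠ 0 ∧ w.1.2 ≠ 0 ∧ w.2 ≠ 0 := by
  have hv : ∀ᵐ v : ℍ ∂(volume : Measure ℍ), v ≠ 0 := by
    rw [ae_iff]; simp only [ne_eq, not_not, Set.setOf_eq_eq_singleton, measure_singleton]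
  have hx : ∀ᵐ w : (ℍ × ℍ) × ℍ ∂volume, w.1.1 ≠ 0 := (Measure.quasiMeasurePreserving_fst.comp Measure.quasiMeasurePreserving_fst).ae hv
  have hy : ∀ᵐ w : (ℍ × ℍ) × ℍ ∂volume, w.1.2 ≠ 0 := (Measure.quasiMeasurePreserving_snd.comp Measure.quasiMeasurePreserving_fst).ae hv
  have hz : ∀ᵐ w : (ℍ × ℍ) × ℍ ∂volume, w.2 ≠ 0 := Measure.quasiMeasurePreserving_snd.ae hv
  filter_upwards [hx, hy, hz] with w a b c using ⟨a, b, c⟩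

/-- `vol³ ∘ (dil3P R⁻¹)⁻¹ = R⁶ · vol³` (`R > 0`; ✓`det_dil3P`, ✓`Measure.addHaar_preimage_linearMap`). [folklore] -/
theorem volume_preimage_dil3P_inv {R : ℝ} (hR : 0 < R) (S : Set ((ℍ × ℍ) × ℍ)) :
    (volume : Measure ((ℍ × ℍ) × ℍ)) ((dil3P R⁻¹) ⁻¹' S) = ENNReal.ofReal (R ^ 6) * (volume : Measure ((ℍ × ℍ) × ℍ)) S := by
  haveI := isAddHaarMeasure_volume3
  have hdet : LinearMap.det (dil3P R⁻¹) ≠ 0 := by rw [det_dil3P]; positivity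
  rw [Measure.addHaar_preimage_linearMap (μ := (volume : Measure ((ℍ × ℍ) × ℍ))) hdet, det_dil3P, inv_pow, inv_inv, abs_of_pos (by positivity)]

/-- ★★ **THE LEADER EVENT'S VOLUME**: for `t, R, ρ > 0`,
`vol³{w | dil3P t w ∈ B³ ∧ axialLetters (hubAt a₀ ρ², dil3P t w) ∈ N₄(R t)} ≤ R⁶ · hubFun (R t) a₀ ρ²`. [cite: Luscher1983, §2] -/
theorem volume_leaderEvent_le {t R : ℝ} (ht : 0 < t) (hR : 0 < R) (a₀ : ℝ) {ρ : ℝ} (hρ : 0 < ρ) :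
    (volume : Measure ((ℍ × ℍ) × ℍ)) {w | dil3P t w ∈ ball3 ∧ axialLetters (hubAt a₀ (ρ ^ 2), dil3P t w) ∈ nearlyCommuting (R * t)} ≤
      ENNReal.ofReal (R ^ 6) * hubFun (R * t) a₀ (ρ ^ 2) := by
  have haxis : axisPoint (hubAt a₀ (ρ ^ 2)) = hubAt a₀ (ρ ^ 2) := axisPoint_hubAt a₀ (ρ ^ 2)
  have ha : hubAt a₀ (ρ ^ 2) ≠ 0 := by
    intro h0
    have h1 : (hubAt a₀ (ρ ^ 2)).imI = 0 := by rw [h0]; rfl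
    have h2 : (hubAt a₀ (ρ ^ 2)).imI = Real.sqrt (ρ ^ 2) := rfl
    rw [h2, Real.sqrt_sq hρ.le] at h1
    exact hρ.ne' h1
  -- up to a null set, the event lies in the dilated K4 event
  have hsub : ∀ᵐ w : (ℍ × ℍ) × ℍ ∂(volume : Measure ((ℍ × ℍ) × ℍ)),
      w ∈ {w | dil3P t w ∈ ball3 ∧ axialLetters (hubAt a₀ (ρ ^ 2), dil3P t w) ∈ nearlyCommuting (R * t)} →
        w ∈ (dil3P R⁻¹) ⁻¹' rescaledSet4 ((R * t) ^ 2) (hubAt a₀ (ρ ^ 2)) := by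
    filter_upwards [ae_volume3_letters_ne_zero] with w hw hmem
    exact dil3P_inv_mem_rescaledSet4 ht hR haxis ha hw.1 hw.2.1 hw.2.2 hmem.1 hmem.2
  calc (volume : Measure ((ℍ × ℍ) × ℍ)) {w | dil3P t w ∈ ball3 ∧ axialLetters (hubAt a₀ (ρ ^ 2), dil3P t w) ∈ nearlyCommuting (R * t)}
      ≤ (volume : Measure ((ℍ × ℍ) × ℍ)) ((dil3P R⁻¹) ⁻¹' rescaledSet4 ((R * t) ^ 2) (hubAt a₀ (ρ ^ 2))) := measure_mono_ae hsub
    _ = ENNReal.ofReal (R ^ 6) * hubFun (R * t) a₀ (ρ ^ 2) := by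
        rw [volume_preimage_dil3P_inv hR, ← volume_rescaledSet4_hubAt (R * t) a₀ hρ]; rfl

/-! ## §2 The periodic kernel is dominated by fcl-p3 g44's radial integrand -/

/-- ★★ **`K_t(a₀, ρ) ≤ (4π · vol^{Fol}(box) · R⁶) · radK (R t) a₀ ρ`** for `ρ > 0` (`t > 0`, `r ≥ 0`, `R = 20L²√r` replaced by any `R ≥ 20L²√r`, `R > 0`),
principal sector, `χ ≡ 1`, level `r·t²`. [cite: Luscher1983, §2] -/
theorem periodicKernel_le_radK {r t R : ℝ} (hr : 0 ≤ r) (ht : 0 < t) (hR : 0 < R) (hRr : 20 * (L : ℝ) ^ 2 * Real.sqrt r ≤ R) (a₀ : ℝ) {ρ : ℝ} (hρ : 0 < ρ) :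
    periodicKernel L (fun _ => false) (fun _ => 1) t (r * t ^ 2) (a₀, ρ) ≤
      (ENNReal.ofReal (4 * Real.pi) *
        ((Measure.pi fun _ : Fol L => (volume : Measure ℍ)) (Set.univ.pi fun _ : Fol L => {y : ℍ | |y.re| < 1 ∧ ‖y.im‖ ≤ 12 * (L : ℝ) ^ 2 * Real.sqrt r}) *
          ENNReal.ofReal (R ^ 6))) * radK (R * t) a₀ ρ := by
  set V : ℝ≥0∞ := (Measure.pi fun _ : Fol L => (volume : Measure ℍ))
    (Set.univ.pi fun _ : Fol L => {y : ℍ | |y.re| < 1 ∧ ‖y.im‖ ≤ 12 * (L : ℝ) ^ 2 * Real.sqrt r}) with hV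
  unfold periodicKernel radK
  simp only
  by_cases hin : a₀ ^ 2 + ρ ^ 2 < 1
  · rw [Set.indicator_of_mem (show ρ ∈ {ρ : ℝ | a₀ ^ 2 + ρ ^ 2 < 1} from hin),
      Set.indicator_of_mem (show ρ ∈ {ρ : ℝ | a₀ ^ 2 + ρ ^ 2 < 1} from hin)]
    -- the fibre mass at the hub: box × leader event, leader event ≤ R⁶·hubFun
    have h1 := periodicFibreMass_le_box_mul_leaderEvent (L := L) hr ht (hubAt a₀ (ρ ^ 2))
    have hmono : (volume : Measure ((ℍ × ℍ) × ℍ)) {w | dil3P t w ∈ ball3 ∧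
        axialLetters (hubAt a₀ (ρ ^ 2), dil3P t w) ∈ nearlyCommuting (20 * (L : ℝ) ^ 2 * Real.sqrt r * t)} ≤
        (volume : Measure ((ℍ × ℍ) × ℍ)) {w | dil3P t w ∈ ball3 ∧ axialLetters (hubAt a₀ (ρ ^ 2), dil3P t w) ∈ nearlyCommuting (R * t)} := by
      refine measure_mono fun w hw => ⟨hw.1, fun k l => (hw.2 k l).trans ?_⟩
      exact mul_le_mul_of_nonneg_right hRr ht.le
    have h2 := volume_leaderEvent_le ht hR a₀ hρ
    calc ENNReal.ofReal (4 * Real.pi) * (ENNReal.ofReal (ρ ^ 2) * periodicFibreMass L (fun _ => false) (fun _ => 1) t (r * t ^ 2) (hubAt a₀ (ρ ^ 2)))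
        ≤ ENNReal.ofReal (4 * Real.pi) * (ENNReal.ofReal (ρ ^ 2) * (V * (ENNReal.ofReal (R ^ 6) * hubFun (R * t) a₀ (ρ ^ 2)))) := by
          gcongr
          exact h1.trans (mul_le_mul' le_rfl (hmono.trans h2))
      _ = ENNReal.ofReal (4 * Real.pi) * (V * ENNReal.ofReal (R ^ 6)) * (ENNReal.ofReal (ρ ^ 2) * hubFun (R * t) a₀ (ρ ^ 2)) := by ring
  · rw [Set.indicator_of_notMem (show ρ ∉ {ρ : ℝ | a₀ ^ 2 + ρ ^ 2 < 1} from hin),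
      Set.indicator_of_notMem (show ρ ∉ {ρ : ℝ | a₀ ^ 2 + ρ ^ 2 < 1} from hin), mul_zero, mul_zero]

/-- The dominating constant is finite. [folklore] -/
theorem dominatingConst_ne_top (r R : ℝ) :
    ENNReal.ofReal (4 * Real.pi) *
        ((Measure.pi fun _ : Fol L => (volume : Measure ℍ)) (Set.univ.pi fun _ : Fol L => {y : ℍ | |y.re| < 1 ∧ ‖y.im‖ ≤ 12 * (L : ℝ) ^ 2 * Real.sqrt r}) *
          ENNReal.ofReal (R ^ 6)) ≠ ∞ :=
  ENNReal.mul_ne_top ENNReal.ofReal_ne_top (ENNReal.mul_ne_top (volume_pi_followerBox_lt_top (L := L) r).ne ENNReal.ofReal_ne_top)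

/-- Integrating the kernel bound over a measurable set of radii `S ⊆ (0, ∞)`. [folklore] -/
theorem lintegral_periodicKernel_le {r t R : ℝ} (hr : 0 ≤ r) (ht : 0 < t) (hR : 0 < R) (hRr : 20 * (L : ℝ) ^ 2 * Real.sqrt r ≤ R)
    {S : Set ℝ} (hS : MeasurableSet S) (hS0 : S ⊆ Ioi 0) :
    ∫⁻ a₀ : ℝ, (∫⁻ ρ in S, periodicKernel L (fun _ => false) (fun _ => 1) t (r * t ^ 2) (a₀, ρ)) ∂(volume : Measure ℝ) ≤
      (ENNReal.ofReal (4 * Real.pi) *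
        ((Measure.pi fun _ : Fol L => (volume : Measure ℍ)) (Set.univ.pi fun _ : Fol L => {y : ℍ | |y.re| < 1 ∧ ‖y.im‖ ≤ 12 * (L : ℝ) ^ 2 * Real.sqrt r}) *
          ENNReal.ofReal (R ^ 6))) * ∫⁻ a₀ : ℝ, ∫⁻ ρ in S, radK (R * t) a₀ ρ := by
  have hC := dominatingConst_ne_top (L := L) r R
  rw [← lintegral_const_mul' _ _ hC]
  refine lintegral_mono fun a₀ => ?_
  rw [← lintegral_const_mul' _ _ hC]
  refine lintegral_mono_ae ?_
  filter_upwards [ae_restrict_mem hS] with ρ hρ using periodicKernel_le_radK hr ht hR hRr a₀ (hS0 hρ)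

/-! ## §3 The deep and outer hypotheses of the log-squeeze lemma -/

/-- ★★★ **(hdeep) FOR THE PERIODIC KERNEL**: for every `A > 0` there is `C < ∞` with `∫⁻ a₀, (∫⁻ ρ in Ioc 0 (A√t), K_t(a₀, ρ)) ≤ C` for all small `t > 0`
(`K_t = periodicKernel 0 1 t (r·t²)`, `r ≥ 0`): fcl-p3 g44's deep bound ✓`lintegral_radK_deep_le` at `τ = R t`, `a = A√t` is `2·(A√2/(64√R))·C_dec`, `t`-free.
[cite: Luscher1983, §2] [cite: GonzalezarroyoAltes1988] -/
theorem periodicKernel_deep {r : ℝ} (hr : 0 ≤ r) (A : ℝ) (hA : 0 < A) :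
    ∃ C : ℝ≥0∞, C ≠ ∞ ∧ ∀ᶠ t in 𝓝[>] (0 : ℝ),
      ∫⁻ a₀ : ℝ, (∫⁻ ρ in Ioc 0 (A * Real.sqrt t), periodicKernel L (fun _ => false) (fun _ => 1) t (r * t ^ 2) (a₀, ρ)) ∂(volume : Measure ℝ) ≤ C := by
  set R : ℝ := 20 * (L : ℝ) ^ 2 * Real.sqrt r + 1 with hRdef
  have hR : 0 < R := by positivity
  have hRr : 20 * (L : ℝ) ^ 2 * Real.sqrt r ≤ R := by rw [hRdef]; linarith
  set K₀ : ℝ≥0∞ := ENNReal.ofReal (4 * Real.pi) *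
    ((Measure.pi fun _ : Fol L => (volume : Measure ℍ)) (Set.univ.pi fun _ : Fol L => {y : ℍ | |y.re| < 1 ∧ ‖y.im‖ ≤ 12 * (L : ℝ) ^ 2 * Real.sqrt r}) *
      ENNReal.ofReal (R ^ 6)) with hK₀
  have hK₀top : K₀ ≠ ∞ := dominatingConst_ne_top (L := L) r R
  refine ⟨K₀ * (ENNReal.ofReal 2 * (ENNReal.ofReal (A * Real.sqrt 2 / (64 * Real.sqrt R)) * decayConst)),
    ENNReal.mul_ne_top hK₀top (ENNReal.mul_ne_top ENNReal.ofReal_ne_top (ENNReal.mul_ne_top ENNReal.ofReal_ne_top decayConst_lt_top.ne)), ?_⟩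
  filter_upwards [eventually_mem_nhdsWithin] with t ht
  have ht0 : 0 < t := ht
  have hRt : 0 < R * t := mul_pos hR ht0
  have ha : 0 < A * Real.sqrt t := mul_pos hA (Real.sqrt_pos.2 ht0)
  have h1 := lintegral_periodicKernel_le (L := L) hr ht0 hR hRr measurableSet_Ioc (fun ρ hρ => hρ.1)
    (S := Ioc 0 (A * Real.sqrt t))
  have h2 := lintegral_radK_deep_le hRt ha
  -- `(A√t)·(√2/(64√(Rt))) = A√2/(64√R)`
  have he : A * Real.sqrt t * (Real.sqrt 2 / (64 * Real.sqrt (R * t))) = A * Real.sqrt 2 / (64 * Real.sqrt R) := by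
    rw [Real.sqrt_mul hR.le]
    have hst : 0 < Real.sqrt t := Real.sqrt_pos.2 ht0
    have hsR : 0 < Real.sqrt R := Real.sqrt_pos.2 hR
    field_simp
  rw [he] at h2
  exact h1.trans (mul_le_mul' le_rfl h2)

/-- ★★★ **(houter) FOR THE PERIODIC KERNEL**: for every `δ > 0` there is `C < ∞` with `∫⁻ a₀, (∫⁻ ρ in Ioi δ, K_t(a₀, ρ)) ≤ C` for all `t > 0`
(✓`lintegral_radK_outer_le`: `2·(1/(64δ))·vol³(domSet4)`, any threshold). [cite: Luscher1983, §2] [cite: GonzalezarroyoAltes1988] -/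
theorem periodicKernel_outer {r : ℝ} (hr : 0 ≤ r) (δ : ℝ) (hδ : 0 < δ) :
    ∃ C : ℝ≥0∞, C ≠ ∞ ∧ ∀ᶠ t in 𝓝[>] (0 : ℝ),
      ∫⁻ a₀ : ℝ, (∫⁻ ρ in Ioi δ, periodicKernel L (fun _ => false) (fun _ => 1) t (r * t ^ 2) (a₀, ρ)) ∂(volume : Measure ℝ) ≤ C := by
  set R : ℝ := 20 * (L : ℝ) ^ 2 * Real.sqrt r + 1 with hRdef
  have hR : 0 < R := by positivity
  have hRr : 20 * (L : ℝ) ^ 2 * Real.sqrt r ≤ R := by rw [hRdef]; linarith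
  set K₀ : ℝ≥0∞ := ENNReal.ofReal (4 * Real.pi) *
    ((Measure.pi fun _ : Fol L => (volume : Measure ℍ)) (Set.univ.pi fun _ : Fol L => {y : ℍ | |y.re| < 1 ∧ ‖y.im‖ ≤ 12 * (L : ℝ) ^ 2 * Real.sqrt r}) *
      ENNReal.ofReal (R ^ 6)) with hK₀
  have hK₀top : K₀ ≠ ∞ := dominatingConst_ne_top (L := L) r R
  refine ⟨K₀ * (ENNReal.ofReal 2 * (ENNReal.ofReal (1 / (64 * δ)) * (((volume : Measure ℍ).prod (volume : Measure ℍ)).prod (volume : Measure ℍ)) domSet4)),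
    ENNReal.mul_ne_top hK₀top (ENNReal.mul_ne_top ENNReal.ofReal_ne_top (ENNReal.mul_ne_top ENNReal.ofReal_ne_top volume_domSet4_lt_top.ne)), ?_⟩
  filter_upwards [eventually_mem_nhdsWithin] with t ht
  have ht0 : 0 < t := ht
  have h1 := lintegral_periodicKernel_le (L := L) hr ht0 hR hRr measurableSet_Ioi (fun ρ hρ => hδ.trans hρ) (S := Ioi δ)
  have h2 := lintegral_radK_outer_le (R * t) hδ
  exact h1.trans (mul_le_mul' le_rfl h2)

end Summit.QuantumFields.YangMills.Theorems.SwapVirialDeficit.BlowUpRing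

end
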